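import Summits.Ventures.Crystal3D.Theorems.StickyWulffConstantCoaxialWallLawSeamPayerFloorStd
import HarnessLib

/-!
# The THREE-PAYER input and the floor-`3` certificate: `ThreePayer → UnionCoreStarCapWin₃ s → both T5b stubs` (under E1)
# (crux `CoaxialWallLaw`, stmt-Ventures-19481; line `WallLedgerF`, skeleton 'CoaxialWallLawCertificates', T5b after the refutation of the v8.2 input `stub_unionCoreCap`)

HONEST FRAMING. Venture `Summits/Ventures/Crystal3D` (cell `crystal3d-full`); sequel of '…SeamPayerFloorStd'.  The thin-piece numerics of this generation
(F-TAIL-g13 §7: kit j334779 — ten and eleven NARROW SPIKES `{q − d, q, q + d, t₂, t₃}` fit around one payer, each loading it with a ball whose certified pool is the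
two-payer floor `2`) show that NO functional of (core, payer) alone certifies the T5b row at the line `2√6` with the facts in the tree: the missing piece is ONE MORE
UNIT OF TRUE POOL at every loaded ball other than the payer.  This file NAMES that piece and shows it suffices for the thin regime's bookkeeping:
* **`ThreePayer`** (NAMED INPUT, analytic / finite kissing question): at every payer `z` of degree `≤ 11` of a `1`-separated `Y`, every (A)-end ball `b ≠ z` within `1`
  of `z` (any version, any plate systems with slot roots) has pooled deficiency `≥ 3`.  The exported two-payer clause gives `≥ 2` ('…SeamPayerFloorStd'
  `two_le_pooledDef_of_hasTwoPayers`); the value `2` is attained in logic only in the sub-case «`deg b = deg z = 11` and every other ball within `1` of `b` saturated»,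
  which `KissingGap`/`KissingClassification` do not exclude (a saturated non-arranged shell has its second unsaturated neighbour possibly just outside `B̄(b, 1)`);
  in every Barlow packing with vacancies the value is `≥ 5`.  OPEN; not claimed;
* `payerPool₃` (`payerPool` at the payer, `max 3 payerPool` elsewhere), `payerSummand₃`, `payerPool₃_le_pooledDef (h3 : ThreePayer)`,
  **`localSummandA_le_payerSummand₃_unionCoreStar (hE1) (h3)`**;
* **`UnionCoreStarCapWin₃ s`** (NAMED INPUT, certificate-shaped, window form, floor `3`): thin pieces now cost `≤ 1/3` per loaded ball (`≤ 11/3 < 2√6` over all contacts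
  of a payer), so the certificate proper only has to bound dense star-closed union cores; `unionCoreStarCapWin₃_of_win`;
* **`localSummandA_le_of_threePayer_of_win₃ (hE1) (h3) (h)`** — `Σ_A(Y, z) ≤ s` at every frame and payer (transport + radius-`3` locality, as in '…SeamPayerFloorStd');
  **`t5b_of_threePayer_of_win₃ : P5Exhaustion → ThreePayer → UnionCoreStarCapWin₃ (2 * Real.sqrt 6) → CoherentSeamSmall (2√6) 3 ∧ IncoherentSeamSmall (2√6) 3`**.
WHAT THIS IS NOT: neither input is proved; F-C1 not moved.
-/

noncomputable section

namespace Summit.Ventures.Crystal3D.Theorems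

namespace TailResidue

open Summit.Ventures.Crystal3D Finset
open scoped InnerProductSpace

/-! ### The three-payer input -/

open scoped Classical in
/-- **THREE-PAYER (named input)**: at every payer `z` of degree `≤ 11` of a `1`-separated configuration, every (A)-end ball `b ≠ z` within `1` of `z` — for any
version and any pair of plate systems with slot roots — has pooled deficiency `pooledDef Y b ≥ 3`.  (The exported two-payer clause gives `≥ 2`.) -/
def ThreePayer : Prop :=
  ∀ Y : Finset (EuclideanSpace ℝ (Fin 3)), (∀ p ∈ Y, ∀ q ∈ Y, p ≠ q → 1 ≤ dist p q) →
  ∀ z ∈ Y, (Y.filter fun q => dist z q = 1).card ≤ 11 →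
  ∀ v : WordVersion, ∀ S₁ S₂ : PlateSystem, S₁.RT ⊆ fccSlots → S₂.RT ⊆ fccSlots →
  ∀ b q : EuclideanSpace ℝ (Fin 3), dist z b ≤ 1 → b ≠ z → IsEndPairA Y v S₁ S₂ b q → 3 ≤ pooledDef Y b

/-! ### The floor-`3` pool and functional -/

section Functional

variable (cap : Finset (EuclideanSpace ℝ (Fin 3)) → EuclideanSpace ℝ (Fin 3) → ℕ)

open scoped Classical in
/-- **THE THREE-PAYER-FLOORED POOL**: `payerPool` at the payer itself, `max 3 payerPool` at every other ball. -/
def payerPool₃ (D : Finset (EuclideanSpace ℝ (Fin 3))) (z b : EuclideanSpace ℝ (Fin 3)) : ℝ :=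
  if b = z then payerPool cap D z b else max 3 (payerPool cap D z b)

open scoped Classical in
/-- **THE THREE-PAYER-FLOORED CAPPED (A)-SUMMAND** of the core `D` at the payer `z`. -/
def payerSummand₃ (v : WordVersion) (S₁ S₂ : PlateSystem) (D : Finset (EuclideanSpace ℝ (Fin 3))) (z : EuclideanSpace ℝ (Fin 3)) : ℝ :=
  ∑ b ∈ D.filter (fun b => dist z b ≤ 1 ∧ 0 < endMultA D v S₁ S₂ b), (endMultA D v S₁ S₂ b : ℝ) / payerPool₃ cap D z b

variable {cap}

open scoped Classical in
/-- The floor `3` only raises the pool. -/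
theorem payerPool_le_payerPool₃ (D : Finset (EuclideanSpace ℝ (Fin 3))) (z b : EuclideanSpace ℝ (Fin 3)) : payerPool cap D z b ≤ payerPool₃ cap D z b := by
  unfold payerPool₃
  split_ifs
  · exact le_rfl
  · exact le_max_right _ _

/-- The three-payer-floored pool is positive. -/
theorem payerPool₃_pos (D : Finset (EuclideanSpace ℝ (Fin 3))) (z b : EuclideanSpace ℝ (Fin 3)) : 0 < payerPool₃ cap D z b :=
  lt_of_lt_of_le (payerPool_pos D z b) (payerPool_le_payerPool₃ D z b)

open scoped Classical in
/-- The floor-`3` functional is at most the payer-floored one. -/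
theorem payerSummand₃_le_payerSummand (v : WordVersion) (S₁ S₂ : PlateSystem) (D : Finset (EuclideanSpace ℝ (Fin 3))) (z : EuclideanSpace ℝ (Fin 3)) :
    payerSummand₃ cap v S₁ S₂ D z ≤ payerSummand cap v S₁ S₂ D z := by
  unfold payerSummand₃ payerSummand
  exact sum_le_sum fun b _ => div_le_div_of_nonneg_left (Nat.cast_nonneg _) (payerPool_pos D z b) (payerPool_le_payerPool₃ D z b)

open scoped Classical in
/-- **Under `ThreePayer`, the floor-`3` pool never exceeds the true pool** at an (A)-end ball within `1` of the payer. -/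
theorem payerPool₃_le_pooledDef (h3 : ThreePayer) {X D : Finset (EuclideanSpace ℝ (Fin 3))} (hX : ∀ p ∈ X, ∀ q ∈ X, p ≠ q → 1 ≤ dist p q) (hDX : D ⊆ X)
    {z : EuclideanSpace ℝ (Fin 3)} (hjunk : ∀ y ∈ D, dist z y ≤ 2 → ((X \ D).filter fun x => dist y x = 1).card ≤ cap D y) (hz : z ∈ X)
    (hdeg : (X.filter fun q => dist z q = 1).card ≤ 11) {v : WordVersion} {S₁ S₂ : PlateSystem} (h₁ : S₁.RT ⊆ fccSlots) (h₂ : S₂.RT ⊆ fccSlots)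
    {b q : EuclideanSpace ℝ (Fin 3)} (hzb : dist z b ≤ 1) (hp : IsEndPairA X v S₁ S₂ b q) : payerPool₃ cap D z b ≤ pooledDef X b := by
  unfold payerPool₃
  split_ifs with hbz
  · exact payerPool_le_pooledDef hX hDX hjunk hz hdeg hzb
  · exact max_le (h3 X hX z hz hdeg v S₁ S₂ h₁ h₂ b q hzb hbz hp) (payerPool_le_pooledDef hX hDX hjunk hz hdeg hzb)

end Functional

/-! ### The comparison with the floor `3` -/

open scoped Classical in
/-- **`Σ_A(Y, z) ≤ payerSummand₃ capTable₃ (unionCoreStar Y z) z`** at every payer of degree `≤ 11`, under E1 and `ThreePayer`. -/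
theorem localSummandA_le_payerSummand₃_unionCoreStar (hE1 : P5Exhaustion) (h3 : ThreePayer) {Y : Finset (EuclideanSpace ℝ (Fin 3))}
    (hY : ∀ p ∈ Y, ∀ p' ∈ Y, p ≠ p' → 1 ≤ dist p p') {v : WordVersion} {S₁ S₂ : PlateSystem} (h₁ : S₁.RT ⊆ fccSlots) (h₂ : S₂.RT ⊆ fccSlots)
    {z : EuclideanSpace ℝ (Fin 3)} (hz : z ∈ Y) (hdeg : (Y.filter fun q => dist z q = 1).card ≤ 11) :
    localSummandA v S₁ S₂ Y z ≤ payerSummand₃ capTable₃ v S₁ S₂ (unionCoreStar Y z v S₁ S₂) z := by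
  set D := unionCoreStar Y z v S₁ S₂ with hDdef
  have hD : IsStarClosed Y z D := isStarClosed_unionCoreStar
  have hDY : D ⊆ Y := hD.subset
  have hjunk : ∀ y ∈ D, dist z y ≤ 2 → ((Y \ D).filter fun x => dist y x = 1).card ≤ capTable₃ D y :=
    fun y hy hzy => junkCapBoundStar_capTable₃ hE1 Y hY z D hD y hy hzy
  unfold localSummandA payerSummand₃
  have hsub : Y.filter (fun b => dist z b ≤ 1 ∧ 0 < endMultA Y v S₁ S₂ b) ⊆ D.filter (fun b => dist z b ≤ 1 ∧ 0 < endMultA D v S₁ S₂ b) := by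
    intro b hb
    obtain ⟨-, hzb, he⟩ := mem_filter.1 hb
    have hle : endMultA Y v S₁ S₂ b ≤ endMultA D v S₁ S₂ b := endMultA_le_unionCoreStar hY h₁ h₂ hzb
    obtain ⟨q, hq⟩ := card_pos.1 he
    have hpD := isEndPairA_unionCoreStar hY h₁ h₂ hzb (mem_filter.1 hq).2
    exact mem_filter.2 ⟨hpD.2.1, hzb, lt_of_lt_of_le he hle⟩
  calc ∑ b ∈ Y.filter (fun b => dist z b ≤ 1 ∧ 0 < endMultA Y v S₁ S₂ b), (endMultA Y v S₁ S₂ b : ℝ) / pooledDef Y b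
      ≤ ∑ b ∈ Y.filter (fun b => dist z b ≤ 1 ∧ 0 < endMultA Y v S₁ S₂ b), (endMultA D v S₁ S₂ b : ℝ) / payerPool₃ capTable₃ D z b := by
        refine sum_le_sum fun b hb => ?_
        obtain ⟨-, hzb, he⟩ := mem_filter.1 hb
        obtain ⟨q, hq⟩ := card_pos.1 he
        exact div_le_div₀ (Nat.cast_nonneg _) (Nat.cast_le.2 (endMultA_le_unionCoreStar hY h₁ h₂ hzb)) (payerPool₃_pos D z b)
          (payerPool₃_le_pooledDef h3 hY hDY hjunk hz hdeg h₁ h₂ hzb (mem_filter.1 hq).2)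
    _ ≤ ∑ b ∈ D.filter (fun b => dist z b ≤ 1 ∧ 0 < endMultA D v S₁ S₂ b), (endMultA D v S₁ S₂ b : ℝ) / payerPool₃ capTable₃ D z b :=
        sum_le_sum_of_subset_of_nonneg hsub fun b _ _ => div_nonneg (Nat.cast_nonneg _) (payerPool₃_pos D z b).le

/-! ### The floor-`3` window certificate and the by-name consequences -/

open scoped Classical in
/-- **STAR-CLOSED UNION-CORE CERTIFICATE, FLOOR 3, WINDOW FORM (named input)**: for every finite `1`-separated `Y ⊆ B̄(0, 3)` containing the payer `0` with degree
`≤ 11`, the three-payer-floored capped (A)-summand (`capTable₃`, `v2`, standard systems) of the star-closed union core of `0` is `≤ s`. -/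
def UnionCoreStarCapWin₃ (s : ℝ) : Prop :=
  ∀ Y : Finset (EuclideanSpace ℝ (Fin 3)), (∀ y ∈ Y, dist (0 : EuclideanSpace ℝ (Fin 3)) y ≤ 3) → (∀ p ∈ Y, ∀ q ∈ Y, p ≠ q → 1 ≤ dist p q) →
  (0 : EuclideanSpace ℝ (Fin 3)) ∈ Y → (Y.filter fun q => dist (0 : EuclideanSpace ℝ (Fin 3)) q = 1).card ≤ 11 →
    payerSummand₃ capTable₃ WordVersion.v2 (basalSystem (LinearIsometryEquiv.refl ℝ (EuclideanSpace ℝ (Fin 3))))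
      (basalSystem (ℝ ∙ EuclideanSpace.single (2 : Fin 3) (1 : ℝ)).reflection)
      (unionCoreStar Y 0 WordVersion.v2 (basalSystem (LinearIsometryEquiv.refl ℝ (EuclideanSpace ℝ (Fin 3))))
        (basalSystem (ℝ ∙ EuclideanSpace.single (2 : Fin 3) (1 : ℝ)).reflection)) 0 ≤ s

/-- Monotonicity in the line. -/
theorem unionCoreStarCapWin₃_mono {s s' : ℝ} (h : UnionCoreStarCapWin₃ s) (hs : s ≤ s') : UnionCoreStarCapWin₃ s' :=
  fun Y hW hY h0 hdeg => (h Y hW hY h0 hdeg).trans hs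

/-- The floor-`2` window certificate implies the floor-`3` one (larger denominators). -/
theorem unionCoreStarCapWin₃_of_win {s : ℝ} (h : UnionCoreStarCapWin s) : UnionCoreStarCapWin₃ s := by
  intro Y hW hY h0 hdeg
  refine le_trans ?_ (h Y hW hY h0 hdeg)
  unfold payerSummand₃ payerSummand₂
  refine sum_le_sum fun b _ => div_le_div_of_nonneg_left (Nat.cast_nonneg _) (payerPool₂_pos _ _ b) ?_
  unfold payerPool₂ payerPool₃
  split_ifs
  · exact le_rfl
  · exact max_le_max (by norm_num) le_rfl

open scoped Classical in
/-- **`P5Exhaustion → ThreePayer → UnionCoreStarCapWin₃ s → Σ_A(Y, z) ≤ s` for EVERY frame and payer** (transport `z ↦ 0`, `L ↦ refl`; radius-`3` locality). -/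
theorem localSummandA_le_of_threePayer_of_win₃ (hE1 : P5Exhaustion) (h3 : ThreePayer) {s : ℝ} (h : UnionCoreStarCapWin₃ s)
    (L : EuclideanSpace ℝ (Fin 3) ≃ₗᵢ[ℝ] EuclideanSpace ℝ (Fin 3)) {Y : Finset (EuclideanSpace ℝ (Fin 3))} (hY : ∀ p ∈ Y, ∀ q ∈ Y, p ≠ q → 1 ≤ dist p q)
    {z : EuclideanSpace ℝ (Fin 3)} (hz : z ∈ Y) (hdeg : (Y.filter fun q => dist z q = 1).card ≤ 11) :
    localSummandA WordVersion.v2 (basalSystem L) (basalSystem (((ℝ ∙ EuclideanSpace.single (2 : Fin 3) (1 : ℝ)).reflection).trans L)) Y z ≤ s := by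
  set H : EuclideanSpace ℝ (Fin 3) ≃ₗᵢ[ℝ] EuclideanSpace ℝ (Fin 3) := (ℝ ∙ EuclideanSpace.single (2 : Fin 3) (1 : ℝ)).reflection with hH
  set X := Y.image fun y => L.symm y + -L.symm z with hXdef
  have hX : ∀ p ∈ X, ∀ q ∈ X, p ≠ q → 1 ≤ dist p q := separated_image_rigid hY L.symm _
  have hYX : Y = X.image fun x => L x + z := by
    have e := image_rigid_symm Y L.symm (-L.symm z)
    simp only [LinearIsometryEquiv.symm_symm, map_neg, LinearIsometryEquiv.apply_symm_apply, neg_neg] at e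
    rw [hXdef, e]
  have h0 : (0 : EuclideanSpace ℝ (Fin 3)) ∈ X := mem_image.2 ⟨z, hz, by simp⟩
  have hzz : z = L 0 + z := by simp
  have hdeg0 : (X.filter fun q => dist (0 : EuclideanSpace ℝ (Fin 3)) q = 1).card ≤ 11 := by
    rw [← degree_transport X L z 0, ← hYX, ← hzz]; exact hdeg
  have key := localSummandA_transport X L z WordVersion.v2 (LinearIsometryEquiv.refl ℝ (EuclideanSpace ℝ (Fin 3))) H basalHexagon basalHexagon 0
  rw [← hYX, ← hzz, LinearIsometryEquiv.refl_trans] at key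
  change localSummandA WordVersion.v2 ⟨L, basalHexagon⟩ ⟨H.trans L, basalHexagon⟩ Y z ≤ s
  rw [key]
  set X₀ := X.filter fun x => dist (0 : EuclideanSpace ℝ (Fin 3)) x ≤ 3 with hX₀def
  have hagree : ∀ x, dist (0 : EuclideanSpace ℝ (Fin 3)) x ≤ 3 → (x ∈ X ↔ x ∈ X₀) := fun x hx => by
    rw [hX₀def, mem_filter]; exact ⟨fun h => ⟨h, hx⟩, fun h => h.1⟩
  have h₁ : (basalSystem (LinearIsometryEquiv.refl ℝ (EuclideanSpace ℝ (Fin 3)))).RT ⊆ fccSlots := filter_subset _ _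
  have h₂ : (basalSystem H).RT ⊆ fccSlots := filter_subset _ _
  have hloc := localSummandA_congr_of_agree (v := WordVersion.v2) hagree h₁ h₂ (z := 0) (by simp)
  change localSummandA WordVersion.v2 (basalSystem (LinearIsometryEquiv.refl ℝ (EuclideanSpace ℝ (Fin 3)))) (basalSystem H) X 0 ≤ s
  rw [hloc]
  have hX₀ : ∀ p ∈ X₀, ∀ q ∈ X₀, p ≠ q → 1 ≤ dist p q := fun p hp q hq hne => hX p (mem_filter.1 hp).1 q (mem_filter.1 hq).1 hne
  have hW : ∀ y ∈ X₀, dist (0 : EuclideanSpace ℝ (Fin 3)) y ≤ 3 := fun y hy => (mem_filter.1 hy).2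
  have h00 : (0 : EuclideanSpace ℝ (Fin 3)) ∈ X₀ := mem_filter.2 ⟨h0, by simp⟩
  have hdeg00 : (X₀.filter fun q => dist (0 : EuclideanSpace ℝ (Fin 3)) q = 1).card ≤ 11 := by
    rw [← degree_congr_of_agree hagree (y := 0) (by simp)]; exact hdeg0
  exact (localSummandA_le_payerSummand₃_unionCoreStar hE1 h3 hX₀ h₁ h₂ h00 hdeg00).trans (h X₀ hW hX₀ h00 hdeg00)

/-- **`P5Exhaustion → ThreePayer → UnionCoreStarCapWin₃ s → SeamResidual s k₀`.** -/
theorem seamResidual_of_threePayer_of_win₃ (hE1 : P5Exhaustion) (h3 : ThreePayer) {s : ℝ} {k₀ : ℕ} (h : UnionCoreStarCapWin₃ s) : SeamResidual s k₀ :=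
  fun L _ hY _ hz hdeg _ _ _ _ => Or.inr (localSummandA_le_of_threePayer_of_win₃ hE1 h3 h L hY hz hdeg)

/-- **`P5Exhaustion → ThreePayer → UnionCoreStarCapWin₃ s → CoherentSeamSmall s k₀`.** -/
theorem coherentSeamSmall_of_threePayer_of_win₃ (hE1 : P5Exhaustion) (h3 : ThreePayer) {s : ℝ} {k₀ : ℕ} (h : UnionCoreStarCapWin₃ s) : CoherentSeamSmall s k₀ :=
  fun L _ hY _ hz hdeg _ _ _ _ _ => Or.inr (localSummandA_le_of_threePayer_of_win₃ hE1 h3 h L hY hz hdeg)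

/-- **`P5Exhaustion → ThreePayer → UnionCoreStarCapWin₃ s → IncoherentSeamSmall s k₀`.** -/
theorem incoherentSeamSmall_of_threePayer_of_win₃ (hE1 : P5Exhaustion) (h3 : ThreePayer) {s : ℝ} {k₀ : ℕ} (h : UnionCoreStarCapWin₃ s) :
    IncoherentSeamSmall s k₀ :=
  fun L _ hY _ hz hdeg _ _ _ _ _ => Or.inr (localSummandA_le_of_threePayer_of_win₃ hE1 h3 h L hY hz hdeg)

/-- **The by-name closers' shape (T5b as two inputs)**: `stub_E1 : P5Exhaustion`, `stub_threePayer : ThreePayer` and `stub_unionCoreStarCapWin₃ : UnionCoreStarCapWin₃ (2√6)`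
close both T5b stubs at `k₀ = 3`. -/
theorem t5b_of_threePayer_of_win₃ (hE1 : P5Exhaustion) (h3 : ThreePayer) (h : UnionCoreStarCapWin₃ (2 * Real.sqrt 6)) :
    CoherentSeamSmall (2 * Real.sqrt 6) 3 ∧ IncoherentSeamSmall (2 * Real.sqrt 6) 3 :=
  ⟨coherentSeamSmall_of_threePayer_of_win₃ hE1 h3 h, incoherentSeamSmall_of_threePayer_of_win₃ hE1 h3 h⟩

end TailResidue

end Summit.Ventures.Crystal3D.Theorems

end
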